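import Summits.QuantumFields.YangMills.Theorems.BalabanUVNodesN12DirectChartLetterHSupportVacuity
import Summits.QuantumFields.YangMills.Theorems.BalabanUVNodesN12GuardedLinAvgRightInverse
import HarnessLib

/-!
# N12 (P4)′ — ONE letter `B` for the right inverse of `DΨ_{U₀}(0)` over a compact set of base points («(P4-unif)»)

Cross-node located piece for DAG node N12 ([15] BALABAN, *The variational problem and background fields in renormalization group method for lattice gauge theories*, CMP 102 (1985) 277,
(45)–(46) p.285, (83) p.290; [III] BALABAN, *Convergent renormalization expansions …*, CMP 119 (1988) 243, (2.2) p.255, (2.11) p.256), in dag-n12-c g20's lane (socket of record, bus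
I.42120 (2)): per instance `i`, at every guarded datum and every minimiser `U₀` of its data, `∃ H, (∀ v, DΨ_{U₀}(0)(H v) = v) ∧ (∀ v, √(Σ_b ‖H v b‖²) ≤ B i‖v‖)` with ONE `B i ≥ 0`
chosen BEFORE the datum and the minimiser.

WHAT THIS FILE CERTIFIES.  p657858 `…N12DirectChartLetterHSupportVacuity` §4 `exists_hH_levelZeroFree_of_surjective` turns surjectivity of `DΨ_{U₀}(0)` into the repaired (P4) binders, but
its letter `B = √#bonds · C_H` is the continuity bound of an ARBITRARY linear right inverse chosen at that base point — a function of `(datum, U₀)`, not of the instance.  Here the letter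
is made UNIFORM over any COMPACT set of base points on which the family `p ↦ DΨ_p(0)` is continuous and pointwise onto:

* §1 (abstract, finite-dimensional target): ★ `exists_rightInverse_of_opNorm_sub_mul_le` — if `T₀` has a right inverse with letter `C` and `‖T − T₀‖·C ≤ 1/2`, then `T` has a right
  inverse with letter `2C` (perturbation through the n10-w1∕n12 lineage's `exists_rightInverse_of_approx`, no Neumann series); ★★ `exists_uniform_rightInverse_of_isCompact` — a family
  `T : X → (E →L[ℝ] F)` continuous on a compact `S` with every `T x` onto admits right inverses with ONE letter on `S` (`IsCompact.induction_on` over §1's neighbourhoods);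
  ★ `continuousOn_clm_of_forall_apply` + ★★ `exists_uniform_rightInverse_of_isCompact_of_forall_apply` — the same with continuity asked per direction `x ↦ T x v` (finite-dimensional
  source; the entrance for families given by explicit per-direction formulas).
* §2 (the leaf in p657858 §4's exact shape): ★★★ `exists_hH_uniform_of_surjective_on_isCompact` — for families of data `W x` and base fields `U x` over a compact parameter set `S` with the
  fibre ∕ guard ∕ surjectivity hypotheses of §4 at every `x ∈ S` and `ContinuousOn (x ↦ DΨ_{(W x, U x)}(0)) S`: ONE `B ≥ 0` and, at every `x ∈ S`, a right inverse `H` with `hHinv`,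
  `hHB : √(Σ_b ‖H v b‖²) ≤ B‖v‖` and the level-0-free support clause `hHsupp′` of p657858 §3; ★★ `…_fibre` (one datum, `U₀` over a compact set of base fields) and ★★★
  `…_of_forall_apply` (continuity asked per direction `x ↦ DΨ_x(0) X₀`) are the two consumer-facing shapes.

RESIDUAL (instance level, the lane's): compactness of the guard's parameter set and continuity of `p ↦ DΨ_p(0)` there (`msChart = suProj ∘ mlog ∘ relAvg ∘ expChart`).  The printed road
([15] (46)) gives a volume-uniform letter by explicit construction; this file is the compactness substitute (non-explicit constant) and asserts nothing of Bałaban's.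

HONEST FRAMING.  Finite-dimensional linear algebra + point-set compactness over landed theorems; count-neutral; N12 ∕ N08 NOT discharged; K1⁹ NOT closed; R4 closes only the conditional
finite-𝕋⁴ rung `BalabanLadder.UV`; nothing continuum ∕ ℝ⁴ ∕ OS ∕ mass gap ∕ Clay.
-/

noncomputable section

open scoped BigOperators Matrix.Norms.L2Operator Topology
open Filter

namespace Summit.QuantumFields.YangMills.BalabanUVNodes.N12DirectChartLetterHUniform

open Summit.QuantumFields.YangMills.BalabanUVNodes.N12GuardedLinAvgRightInverse (exists_rightInverse_of_approx)

/-! ## §1  Abstract engine: right inverses with one letter over a compact family -/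

section Abstract

variable {E F' : Type*} [NormedAddCommGroup E] [NormedSpace ℝ E] [NormedAddCommGroup F'] [NormedSpace ℝ F'] [FiniteDimensional ℝ F']

/-- ★ **PERTURBATION OF A RIGHT INVERSE** (finite-dimensional target): if `T₀` has a right inverse `g₀` with letter `C ≥ 0` (`‖g₀ y‖ ≤ C‖y‖`) and `‖T − T₀‖·C ≤ 1/2`, then `T` has a linear
right inverse with letter `2C`.  Proof: `‖T (g₀ y) − y‖ = ‖(T − T₀)(g₀ y)‖ ≤ ½‖y‖`, then `exists_rightInverse_of_approx` (injective ⇒ bijective on the finite-dimensional target; no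
Neumann series). [cite: Balaban1985Variational, (45)–(46) p.285 (bookkeeping: the letter of a right inverse)] -/
theorem exists_rightInverse_of_opNorm_sub_mul_le (T₀ T : E →L[ℝ] F') (g₀ : F' →L[ℝ] E) (hg₀ : ∀ y, T₀ (g₀ y) = y)
    {C : ℝ} (hC0 : 0 ≤ C) (hC : ∀ y, ‖g₀ y‖ ≤ C * ‖y‖) (hclose : ‖T - T₀‖ * C ≤ 1 / 2) :
    ∃ H : F' →ₗ[ℝ] E, (∀ y, T (H y) = y) ∧ ∀ y, ‖H y‖ ≤ 2 * C * ‖y‖ := by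
  have happrox : ∀ y, ‖T.toLinearMap (g₀.toLinearMap y) - y‖ ≤ (1 / 2 : ℝ) * ‖y‖ := fun y => by
    have h1 : T (g₀ y) - y = (T - T₀) (g₀ y) := by
      show T (g₀ y) - y = T (g₀ y) - T₀ (g₀ y)
      rw [hg₀]
    calc ‖T.toLinearMap (g₀.toLinearMap y) - y‖ = ‖(T - T₀) (g₀ y)‖ := by
          rw [ContinuousLinearMap.coe_coe, ContinuousLinearMap.coe_coe, h1]
      _ ≤ ‖T - T₀‖ * ‖g₀ y‖ := (T - T₀).le_opNorm _
      _ ≤ ‖T - T₀‖ * (C * ‖y‖) := mul_le_mul_of_nonneg_left (hC y) (norm_nonneg _)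
      _ = ‖T - T₀‖ * C * ‖y‖ := by ring
      _ ≤ 1 / 2 * ‖y‖ := mul_le_mul_of_nonneg_right hclose (norm_nonneg _)
  obtain ⟨G, hG, hGB⟩ := exists_rightInverse_of_approx T.toLinearMap g₀.toLinearMap (q := 1 / 2) (by norm_num) happrox
  refine ⟨g₀.toLinearMap ∘ₗ G, fun y => ?_, fun y => ?_⟩
  · have h := hG y
    rw [ContinuousLinearMap.coe_coe, ContinuousLinearMap.coe_coe] at h
    rw [LinearMap.comp_apply, ContinuousLinearMap.coe_coe]
    exact h
  · rw [LinearMap.comp_apply, ContinuousLinearMap.coe_coe]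
    calc ‖g₀ (G y)‖ ≤ C * ‖G y‖ := hC _
      _ ≤ C * ((1 - 1 / 2)⁻¹ * ‖y‖) := mul_le_mul_of_nonneg_left (hGB y) hC0
      _ = 2 * C * ‖y‖ := by norm_num; ring

/-- ★★ **ONE LETTER OVER A COMPACT FAMILY**: a family `T : X → (E →L[ℝ] F)` into a finite-dimensional `F`, continuous on a compact `S ⊆ X` with every `T x` (`x ∈ S`) onto, admits linear
right inverses with ONE letter: `∃ B ≥ 0, ∀ x ∈ S, ∃ H, (∀ y, T x (H y) = y) ∧ ∀ y, ‖H y‖ ≤ B‖y‖`.  Proof: at `x₀ ∈ S` a continuous right inverse `g₀` (finite-dimensional target) with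
letter `‖g₀‖`; on the neighbourhood `‖T x − T x₀‖ < 1∕(2(‖g₀‖+1))` within `S` the perturbation lemma gives letter `2‖g₀‖`; `IsCompact.induction_on` (finite union ⇒ `max`).  The constant is
NOT explicit. [cite: Balaban1985Variational, (45)–(46) p.285 (bookkeeping: uniformity of the letter; print's (46) is explicit and volume-uniform — this is the compactness substitute)] -/
theorem exists_uniform_rightInverse_of_isCompact {X : Type*} [TopologicalSpace X] {S : Set X} (hS : IsCompact S)
    {T : X → E →L[ℝ] F'} (hT : ContinuousOn T S) (hsurj : ∀ x ∈ S, Function.Surjective (T x)) :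
    ∃ B : ℝ, 0 ≤ B ∧ ∀ x ∈ S, ∃ H : F' →ₗ[ℝ] E, (∀ y, T x (H y) = y) ∧ ∀ y, ‖H y‖ ≤ B * ‖y‖ := by
  classical
  suffices h : ∃ B : ℝ, 0 ≤ B ∧ ∀ x ∈ S, x ∈ S → ∃ H : F' →ₗ[ℝ] E, (∀ y, T x (H y) = y) ∧ ∀ y, ‖H y‖ ≤ B * ‖y‖ by
    obtain ⟨B, hB, h⟩ := h
    exact ⟨B, hB, fun x hx => h x hx hx⟩
  refine hS.induction_on
    (p := fun t => ∃ B : ℝ, 0 ≤ B ∧ ∀ x ∈ t, x ∈ S → ∃ H : F' →ₗ[ℝ] E, (∀ y, T x (H y) = y) ∧ ∀ y, ‖H y‖ ≤ B * ‖y‖)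
    ⟨0, le_rfl, fun x hx _ => absurd hx (Set.notMem_empty x)⟩ ?_ ?_ ?_
  · rintro s t hst ⟨B, hB, h⟩
    exact ⟨B, hB, fun x hx hxS => h x (hst hx) hxS⟩
  · rintro s t ⟨B₁, hB₁, h₁⟩ ⟨B₂, hB₂, h₂⟩
    refine ⟨max B₁ B₂, hB₁.trans (le_max_left _ _), fun x hx hxS => ?_⟩
    rcases hx with hx | hx
    · obtain ⟨H, hH, hHB⟩ := h₁ x hx hxS
      exact ⟨H, hH, fun y => (hHB y).trans (mul_le_mul_of_nonneg_right (le_max_left _ _) (norm_nonneg _))⟩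
    · obtain ⟨H, hH, hHB⟩ := h₂ x hx hxS
      exact ⟨H, hH, fun y => (hHB y).trans (mul_le_mul_of_nonneg_right (le_max_right _ _) (norm_nonneg _))⟩
  · intro x₀ hx₀
    have hrange : (T x₀).range = ⊤ := LinearMap.range_eq_top.2 (hsurj x₀ hx₀)
    obtain ⟨g₀, hg₀⟩ := (T x₀).exists_rightInverse_of_surjective hrange
    have hg₀' : ∀ y, T x₀ (g₀ y) = y := fun y => by
      have h := congrArg (fun f : F' →L[ℝ] F' => f y) hg₀
      simpa only [ContinuousLinearMap.comp_apply, ContinuousLinearMap.id_apply] using h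
    set C : ℝ := ‖g₀‖ with hCdef
    have hC0 : 0 ≤ C := norm_nonneg _
    have hC : ∀ y, ‖g₀ y‖ ≤ C * ‖y‖ := fun y => g₀.le_opNorm y
    set δ : ℝ := 1 / (2 * (C + 1)) with hδ
    have hδ0 : 0 < δ := by rw [hδ]; positivity
    refine ⟨T ⁻¹' Metric.ball (T x₀) δ, (hT x₀ hx₀).preimage_mem_nhdsWithin (Metric.ball_mem_nhds _ hδ0),
      2 * C, by positivity, fun x hx _ => ?_⟩
    have hxδ : ‖T x - T x₀‖ < δ := by rw [← dist_eq_norm]; exact hx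
    have hclose : ‖T x - T x₀‖ * C ≤ 1 / 2 := by
      calc ‖T x - T x₀‖ * C ≤ δ * C := mul_le_mul_of_nonneg_right hxδ.le hC0
        _ = C / (2 * (C + 1)) := by rw [hδ]; ring
        _ ≤ 1 / 2 := by
          rw [div_le_div_iff₀ (by positivity) (by norm_num)]
          nlinarith
    exact exists_rightInverse_of_opNorm_sub_mul_le (T x₀) (T x) g₀ hg₀' hC0 hC hclose

omit [FiniteDimensional ℝ F'] in
/-- ★ **OPERATOR-NORM CONTINUITY FROM POINTWISE CONTINUITY** (finite-dimensional SOURCE): if every orbit `x ↦ T x v` is continuous on `S`, then `x ↦ T x` is continuous on `S` in the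
operator norm (`Module.Basis.exists_opNorm_le` on a finite basis; the convenient entrance for families given by explicit per-direction formulas such as `v ↦ DΨ_x(0) v`).
[cite: Balaban1985Variational, (83) p.290 (bookkeeping: the chart's derivative as a family in the base point)] -/
theorem continuousOn_clm_of_forall_apply [FiniteDimensional ℝ E] {X : Type*} [TopologicalSpace X] {S : Set X}
    {T : X → E →L[ℝ] F'} (h : ∀ v : E, ContinuousOn (fun x => T x v) S) : ContinuousOn T S := by
  classical
  intro x₀ hx₀
  obtain ⟨C, hC0, hC⟩ := (Module.finBasis ℝ E).exists_opNorm_le (F := F')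
  refine Metric.tendsto_nhds.2 fun ε hε => ?_
  have hε' : 0 < ε / (2 * C) := by positivity
  have hev : ∀ᶠ x in 𝓝[S] x₀, ∀ i, dist (T x ((Module.finBasis ℝ E) i)) (T x₀ ((Module.finBasis ℝ E) i)) < ε / (2 * C) :=
    Filter.eventually_all.2 fun i => Metric.tendsto_nhds.1 (h _ x₀ hx₀) _ hε'
  refine hev.mono fun x hx => ?_
  have hle : ‖T x - T x₀‖ ≤ C * (ε / (2 * C)) :=
    hC hε'.le fun i => by
      have hi := (hx i).le
      rwa [dist_eq_norm] at hi
  rw [dist_eq_norm]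
  calc ‖T x - T x₀‖ ≤ C * (ε / (2 * C)) := hle
    _ = ε / 2 := by field_simp
    _ < ε := by linarith

/-- ★★ **ONE LETTER OVER A COMPACT FAMILY — POINTWISE-CONTINUITY ENTRANCE** (finite-dimensional source AND target): as `exists_uniform_rightInverse_of_isCompact`, with the continuity
hypothesis weakened to `∀ v, ContinuousOn (x ↦ T x v) S`. [cite: Balaban1985Variational, (45)–(46) p.285 (bookkeeping)] -/
theorem exists_uniform_rightInverse_of_isCompact_of_forall_apply [FiniteDimensional ℝ E] {X : Type*} [TopologicalSpace X] {S : Set X} (hS : IsCompact S)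
    {T : X → E →L[ℝ] F'} (hT : ∀ v : E, ContinuousOn (fun x => T x v) S) (hsurj : ∀ x ∈ S, Function.Surjective (T x)) :
    ∃ B : ℝ, 0 ≤ B ∧ ∀ x ∈ S, ∃ H : F' →ₗ[ℝ] E, (∀ y, T x (H y) = y) ∧ ∀ y, ‖H y‖ ≤ B * ‖y‖ :=
  exists_uniform_rightInverse_of_isCompact hS (continuousOn_clm_of_forall_apply hT) hsurj

end Abstract

/-! ## §2  The (P4-unif) leaf in p657858 §4's exact shape -/

section N12

open Literature.MathematicalPhysics.QuantumFieldTheory.Balaban1983to89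
open T4Continuum (T4Family)
open T4AdjointCovarianceUnitary (lieSU)
open B15DeterminingSets GaugeField
open B14.Eq213DetSet (Bj maxDomT)
open Node00
open Summit.QuantumFields.YangMills.BalabanUVNodes.N12RightInverseLevelZeroLocality (mem_bondsOf_Bj_zero)
open Summit.QuantumFields.YangMills.BalabanUVNodes.N12DirectChartLetterHSupportVacuity (hHsupp_levelZeroFree_of_rightInverse)
open Summit.QuantumFields.YangMills.BalabanUVNodes.N12NearFlatChartLetter (l2Seminorm_le_sqrt_card_mul_norm l2Seminorm_apply)

variable {F : T4Family} {N : ℕ} [NeZero N] {K k : ℕ}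

/-- ★★★ **(P4-unif) — ONE LETTER OVER A COMPACT SET OF BASE POINTS** (general `N`, `k ≥ 1`, region `Z`, thickness `M₁`): let `S` be a compact subset of any parameter space `X`, and
`W x`, `U x` (`x ∈ X`) families of data and base fields such that at every `x ∈ S`: `U x` lies in the fibre of `W x` on `𝐁_k(Z)` (`AgreeOn`), the guard `SmallBelow (avOfRecord F N K) k (U x)`
holds, and `DΨ_x(0) := fderiv ℝ (msChart F N K k 𝐁_k(Z) (W x) (U x)) 0` is ONTO; and let `x ↦ DΨ_x(0)` be continuous on `S`.  Then there is ONE `B ≥ 0` such that at every `x ∈ S`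
the repaired (P4) binders of p657858 §4 hold with that `B`: a right inverse `H` (`hHinv`), the letter `hHB : √(Σ_b ‖H v b‖²) ≤ B‖v‖`, and the level-0-free support clause `hHsupp′`.
(`B = √#bonds · B₁`, `B₁` = §1's uniform letter; `hHsupp′` by p657858 §3 for every right inverse.)  Consumers: dag-n12-c g20's socket of record (one `B i` per instance) when the
(P4)′ producer delivers `hsurj` pointwise — the instance supplies compactness of its guard set and continuity of `p ↦ DΨ_p(0)`. [cite: Balaban1985Variational, (45)–(46) p.285, (83) p.290;
Balaban1988Convergent, (2.2) p.255, (2.11) p.256] -/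
theorem exists_hH_uniform_of_surjective_on_isCompact {M₁ : ℕ} (hk : 0 < k) {Z : Set (Site (F.P K) 0)}
    {X : Type*} [TopologicalSpace X] {S : Set X} (hS : IsCompact S)
    (W : X → MSField (F.P K) (SU N)) (U : X → GaugeField (F.P K) 0 (SU N))
    (hU : ∀ x ∈ S, AgreeOn (Bj M₁ Z k) (avgFamily (avOfRecord F N K) (U x)) (W x))
    (hsb : ∀ x ∈ S, SmallBelow (avOfRecord F N K) k (U x))
    (hcont : ContinuousOn (fun x => fderiv ℝ (msChart F N K k (Bj M₁ Z k) (W x) (U x)) 0) S)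
    (hsurj : ∀ x ∈ S, Function.Surjective (fderiv ℝ (msChart F N K k (Bj M₁ Z k) (W x) (U x)) 0)) :
    ∃ B : ℝ, 0 ≤ B ∧ ∀ x ∈ S,
      ∃ H : (Fin (constrCard (Bj M₁ Z k : DetSet (F.P K)) k) → lieSU (Fin N)) → PBond (F.P K) 0 → lieSU (Fin N),
        (∀ v, fderiv ℝ (msChart F N K k (Bj M₁ Z k) (W x) (U x)) 0 (H v) = v) ∧
        (∀ v, Real.sqrt (∑ b, ‖H v b‖ ^ 2) ≤ B * ‖v‖) ∧
        (∀ v, (∀ (c : PBond (F.P K) 0) (hc : c.src ∉ maxDomT M₁ Z 1),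
            v (constrEnum (Bj M₁ Z k : DetSet (F.P K)) k ⟨⟨0, Nat.succ_pos k⟩, c, (mem_bondsOf_Bj_zero hk Z c).2 (Or.inl hc)⟩) = 0) →
          ∀ b : PBond (F.P K) 0, b.src ∉ maxDomT M₁ Z 1 → H v b = 0) := by
  obtain ⟨B₁, hB₁, hB⟩ := exists_uniform_rightInverse_of_isCompact hS hcont hsurj
  refine ⟨Real.sqrt (Fintype.card (PBond (F.P K) 0)) * B₁, by positivity, fun x hx => ?_⟩
  obtain ⟨g, hg, hgB⟩ := hB x hx
  refine ⟨fun v => g v, hg, fun v => ?_,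
    fun v hv b hb => hHsupp_levelZeroFree_of_rightInverse hk (hU x hx) (hsb x hx) (fun v => g v) hg v hv b hb⟩
  rw [← l2Seminorm_apply (g v)]
  calc (normSeminorm ℝ (PiLp 2 (fun _ : PBond (F.P K) 0 => lieSU (Fin N)))).comp (WithLp.linearEquiv 2 ℝ (PBond (F.P K) 0 → lieSU (Fin N))).symm.toLinearMap (g v)
      ≤ Real.sqrt (Fintype.card (PBond (F.P K) 0)) * ‖g v‖ := l2Seminorm_le_sqrt_card_mul_norm (g v)
    _ ≤ Real.sqrt (Fintype.card (PBond (F.P K) 0)) * (B₁ * ‖v‖) := mul_le_mul_of_nonneg_left (hgB v) (Real.sqrt_nonneg _)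
    _ = Real.sqrt (Fintype.card (PBond (F.P K) 0)) * B₁ * ‖v‖ := by ring

/-- ★★ **THE SAME OVER A COMPACT SET OF BASE FIELDS AT ONE DATUM** (the shape of a single guarded instance: datum `W` fixed, `U₀` ranging over a compact set `G` of minimisers in its fibre on
the guard — e.g. a closed guard inside the compact configuration space): ONE `B ≥ 0` for all `U₀ ∈ G`. [cite: Balaban1985Variational, (45)–(46) p.285, (83) p.290; Balaban1988Convergent, (2.11) p.256] -/
theorem exists_hH_uniform_of_surjective_on_isCompact_fibre {M₁ : ℕ} (hk : 0 < k) {Z : Set (Site (F.P K) 0)} {W : MSField (F.P K) (SU N)}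
    [TopologicalSpace (GaugeField (F.P K) 0 (SU N))] {G : Set (GaugeField (F.P K) 0 (SU N))} (hG : IsCompact G)
    (hU : ∀ U₀ ∈ G, AgreeOn (Bj M₁ Z k) (avgFamily (avOfRecord F N K) U₀) W)
    (hsb : ∀ U₀ ∈ G, SmallBelow (avOfRecord F N K) k U₀)
    (hcont : ContinuousOn (fun U₀ => fderiv ℝ (msChart F N K k (Bj M₁ Z k) W U₀) 0) G)
    (hsurj : ∀ U₀ ∈ G, Function.Surjective (fderiv ℝ (msChart F N K k (Bj M₁ Z k) W U₀) 0)) :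
    ∃ B : ℝ, 0 ≤ B ∧ ∀ U₀ ∈ G,
      ∃ H : (Fin (constrCard (Bj M₁ Z k : DetSet (F.P K)) k) → lieSU (Fin N)) → PBond (F.P K) 0 → lieSU (Fin N),
        (∀ v, fderiv ℝ (msChart F N K k (Bj M₁ Z k) W U₀) 0 (H v) = v) ∧
        (∀ v, Real.sqrt (∑ b, ‖H v b‖ ^ 2) ≤ B * ‖v‖) ∧
        (∀ v, (∀ (c : PBond (F.P K) 0) (hc : c.src ∉ maxDomT M₁ Z 1),
            v (constrEnum (Bj M₁ Z k : DetSet (F.P K)) k ⟨⟨0, Nat.succ_pos k⟩, c, (mem_bondsOf_Bj_zero hk Z c).2 (Or.inl hc)⟩) = 0) →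
          ∀ b : PBond (F.P K) 0, b.src ∉ maxDomT M₁ Z 1 → H v b = 0) :=
  exists_hH_uniform_of_surjective_on_isCompact hk hG (fun _ => W) (fun U₀ => U₀) hU hsb hcont hsurj

/-- ★★★ **(P4-unif), POINTWISE-CONTINUITY ENTRANCE** — as `exists_hH_uniform_of_surjective_on_isCompact`, with the continuity hypothesis stated per direction:
`∀ X, ContinuousOn (x ↦ DΨ_x(0) X) S` (the form Node00's per-component derivative formulas deliver). [cite: Balaban1985Variational, (45)–(46) p.285, (83) p.290; Balaban1988Convergent, (2.11) p.256] -/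
theorem exists_hH_uniform_of_surjective_on_isCompact_of_forall_apply {M₁ : ℕ} (hk : 0 < k) {Z : Set (Site (F.P K) 0)}
    {X : Type*} [TopologicalSpace X] {S : Set X} (hS : IsCompact S)
    (W : X → MSField (F.P K) (SU N)) (U : X → GaugeField (F.P K) 0 (SU N))
    (hU : ∀ x ∈ S, AgreeOn (Bj M₁ Z k) (avgFamily (avOfRecord F N K) (U x)) (W x))
    (hsb : ∀ x ∈ S, SmallBelow (avOfRecord F N K) k (U x))
    (hcont : ∀ X₀ : PBond (F.P K) 0 → lieSU (Fin N), ContinuousOn (fun x => fderiv ℝ (msChart F N K k (Bj M₁ Z k) (W x) (U x)) 0 X₀) S)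
    (hsurj : ∀ x ∈ S, Function.Surjective (fderiv ℝ (msChart F N K k (Bj M₁ Z k) (W x) (U x)) 0)) :
    ∃ B : ℝ, 0 ≤ B ∧ ∀ x ∈ S,
      ∃ H : (Fin (constrCard (Bj M₁ Z k : DetSet (F.P K)) k) → lieSU (Fin N)) → PBond (F.P K) 0 → lieSU (Fin N),
        (∀ v, fderiv ℝ (msChart F N K k (Bj M₁ Z k) (W x) (U x)) 0 (H v) = v) ∧
        (∀ v, Real.sqrt (∑ b, ‖H v b‖ ^ 2) ≤ B * ‖v‖) ∧
        (∀ v, (∀ (c : PBond (F.P K) 0) (hc : c.src ∉ maxDomT M₁ Z 1),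
            v (constrEnum (Bj M₁ Z k : DetSet (F.P K)) k ⟨⟨0, Nat.succ_pos k⟩, c, (mem_bondsOf_Bj_zero hk Z c).2 (Or.inl hc)⟩) = 0) →
          ∀ b : PBond (F.P K) 0, b.src ∉ maxDomT M₁ Z 1 → H v b = 0) :=
  exists_hH_uniform_of_surjective_on_isCompact hk hS W U hU hsb (continuousOn_clm_of_forall_apply hcont) hsurj

end N12

end Summit.QuantumFields.YangMills.BalabanUVNodes.N12DirectChartLetterHUniform

end
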